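import Summits.BirchSwinnertonDyer.Rank1Residual.Supersingular.KobayashiMainConjectureX7FouquetWanCrystalline
import Summits.BirchSwinnertonDyer.Rank1Residual.Supersingular.TwistStability
import Summits.BirchSwinnertonDyer.Rank1Residual.Supersingular.X7TwistClauseOPEN
import Summits.BirchSwinnertonDyer.Rank1Residual.AdditivePotMult.QuadraticTwistTamagawaMultiplicative
import Summits.BirchSwinnertonDyer.Rank1Residual.AdditivePotMult.QuadraticTwistTamagawaMultiplicativeTwo
import Summits.BirchSwinnertonDyer.Rank1Residual.GaloisImage.JWitnessTowerSurjectivity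
import Summits.BirchSwinnertonDyer.Rank1Residual.X2.RankOne
import Literature.NumberTheory.EllipticCurves.LocalTorsionMultiplicativeProofs
import Literature.NumberTheory.DiophantineGeometry.MinimalDiscriminantSmulProofs
import Literature.NumberTheory.EllipticCurves.ComplexMultiplicationHasCMProofs
import Literature.NumberTheory.EllipticCurves.OrdinaryPrimesProofs
import Mathlib.NumberTheory.LSeries.PrimesInAP
import HarnessLib

/-!
# Route `SignedLowerHalves`, crux `KobayashiLowerHalfLargeImage` (item stmt-BirchSwinnertonDyer-19001):
# TWIST-TO-LOCUS — every X7 large-image curve with a `ρ̄`-ramified SPLIT multiplicative odd prime is ONE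
# QUADRATIC TWIST away from the Fouquet–Wan locus (cell `bsd-ssimc`, seat `bsd-ssimc-k3-c3` gen 3; a
# `--supports … --as helper` file, closes nothing). Companion: `…LargeImageReduction.lean` (§§1–3).

PARTITION (cell bsd-ssimc): X7 (A7) × the off-FW-locus pieces B (150) and C (87) of MEMO-3 §T — the
277 − 16 − 1 − 23 large-image window pairs whose `ρ̄`-ramified multiplicative primes are ALL of split
type — types-the-object-of; closes NONE. THEOREMS ONLY; no definition, no new named fact; nothing about
any curve is asserted; FW stays PRE; BSD is not proved by any of this.

## What this file records (namespace `Summit.BirchSwinnertonDyer.BirchSwinnertonDyer.Theorems`)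

The Fouquet–Wan locus of crux 3 (registered stub `stub_fwLocus`) asks for a prime `ℓ ≠ p` of NON-SPLIT
multiplicative reduction with `p ∤ ord_ℓ Δ_min` (FW arXiv:2107.13726 Thm 4.51 (iii): under FW's
convention `ρ_f = T_pE(−1)`, «`dim ρ̄^{G_ℓ} = 0`» ⟺ the unramified quadratic character of the
Steinberg twist is non-trivial ⟺ non-split). If instead `W` (X7, `a_p = 0`, `ρ̄` onto, no CM) has such
a prime `ℓ ∤ 2p` of SPLIT type, then for every prime `q ∉ {2, p}` of good reduction which is a quadratic
NON-residue mod `ℓ` (Dirichlet's theorem, `Nat.forall_exists_prime_gt_and_eq_mod`, in a non-square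
class of `(ℤ/ℓ)^×`), every globally minimal model `W'` of the twist `W^{(q)}`:
* is NON-SPLIT multiplicative at `ℓ` with the SAME `ord_ℓ Δ_min`
  (`nonsplit_of_smul_eq_quadraticTwist_of_not_isSquare`: the unit twist at an odd multiplicative place,
  tree `AdditivePotMult.hasMultiplicativeReductionAt_and_split_iff_quadraticTwist_of_not_dvd`, plus the
  `ℚ`-isomorphism invariance of type and of `ord Δ_min`);
* is an X7 pair at `p` with `a_p = 0`, `ρ̄` onto, no CM (`classX7_of_smul_eq_quadraticTwist_prime`:
  `TwistStability`, additivity at `q`, `ρ̄_{E^{(q)},p} ≅ ρ̄_{E,p} ⊗ χ`, same `j`);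
so `W'` lies ON the Fouquet–Wan locus (`exists_twist_on_fwLocus_of_split_ram`, a THEOREM, no binder),
and the FW binder yields Kobayashi's main conjecture for `W'`, both signs
(`exists_twist_kobayashiMainConjecture_of_thm451_OPEN`, CONDITIONAL).

Reading (MEMO-4 §F of this seat): the split/non-split datum that separates pieces B ∪ C from the locus
is a choice of quadratic twist, not an invariant of `ρ̄` or of the conductor exponent at `ℓ`; what is
missing off the locus is a TWIST DESCENT for Kobayashi's conjecture along `ℚ(√q*)` (equivalently the
cyclotomic-line main conjecture over that quadratic field), not a new Eisenstein family at `E` — and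
the a_ℓ-blind route of BSTW II §2.3 (auxiliary prime INERT in the CM field) is the printed shape of
such an engine for semistable `E`. Nothing here descends: `KobayashiLowerDivisibility` is not known
to be twist-invariant, and no such claim is typed; the dyadic case `ℓ = 2` is not treated.

References: [FouquetWan2021] Thm 4.51 / 1.13 (PRE); [Kobayashi2003] Thm. 7.4, Conjecture (p. 2);
[SilvermanAEC2009] VII.5 Prop. 5.1, X.5 Cor. 5.4, III.1.4(b), VIII.8 Cor. 8.3; [Knapp1993] Prop. 12.10;
[BurungaleSkinnerTianWan2024] II §2.3 (PRE, for comparison only); cell memos k3-c3 MEMO-1 §A,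
MEMO-3 §T, MEMO-4 (this gen).
-/

set_option autoImplicit false
set_option linter.dupNamespace false

noncomputable section

open scoped Classical MatrixGroups ModularForm

open CongruenceSubgroup WeierstrassCurve IsDedekindDomain NumberField Rat.HeightOneSpectrum
  Literature.NumberTheory.EllipticCurves
  Literature.NumberTheory.EllipticCurves.ModularForms
  Literature.NumberTheory.EllipticCurves.Rank1Residual
  Literature.NumberTheory.EllipticCurves.Rank1Residual.Typed
  Summit.BirchSwinnertonDyer.Rank1Residual.Supersingular

namespace Summit.BirchSwinnertonDyer.BirchSwinnertonDyer.Theorems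

/-! ### §4 Twist-to-locus: a split `ρ̄`-ramified multiplicative prime becomes non-split after one twist -/

section TwistToLocus

variable (W W' : WeierstrassCurve ℚ) [W.IsElliptic] [W.IsGloballyMinimal] [W'.IsElliptic]
  [W'.IsGloballyMinimal]

/-- **Local part.** Let `C • W' = W^{(d)}` with `W, W'` globally minimal, `ℓ` an ODD prime with
`ℓ ∤ d` at which `W` has SPLIT multiplicative reduction, and `d` a quadratic NON-residue mod `ℓ`. Then
`W'` has NON-SPLIT multiplicative reduction at `ℓ` and `ord_ℓ Δ_min(W') = ord_ℓ Δ_min(W)`: the unit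
twist at an odd multiplicative place keeps the type and `ord Δ_min` and is split iff
`(d/ℓ) = 1 ⟺ W` split (`AdditivePotMult.hasMultiplicativeReductionAt_and_split_iff_quadraticTwist_of_not_dvd`),
and all three are `ℚ`-isomorphism invariants. [cite: SilvermanAEC2009, VII.5 Prop. 5.1(b) and X.5 Cor. 5.4] -/
theorem nonsplit_of_smul_eq_quadraticTwist_of_not_isSquare {d : ℤ} {C : VariableChange ℚ}
    (hC : C • W' = W.quadraticTwist (d : ℚ)) (ℓ : ℕ) [Fact ℓ.Prime] (hℓ2 : ℓ ≠ 2)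
    (hℓd : ¬ (ℓ : ℤ) ∣ d) (hns : ¬ IsSquare ((d : ℤ) : ZMod ℓ))
    (hmult : W.HasMultiplicativeReductionAtPrime ℓ) (hsplit : W.HasSplitMultiplicativeReductionAtPrime ℓ) :
    W'.HasMultiplicativeReductionAtPrime ℓ ∧ ¬ W'.HasSplitMultiplicativeReductionAtPrime ℓ ∧
      padicValInt ℓ W'.minimalDiscriminantInt = padicValInt ℓ W.minimalDiscriminantInt := by
  have hd0 : (d : ℚ) ≠ 0 := by
    have : d ≠ 0 := fun h ↦ hℓd (by rw [h]; exact dvd_zero _)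
    exact_mod_cast this
  haveI := W.isElliptic_quadraticTwist hd0
  obtain ⟨v, rfl⟩ : ∃ v : HeightOneSpectrum (𝓞 ℚ), ((primesEquiv v : ℕ)) = ℓ :=
    ⟨primesEquiv.symm ⟨ℓ, Fact.out⟩, by rw [Equiv.apply_symm_apply]⟩
  have hWv : W.HasMultiplicativeReductionAt v :=
    (hasMultiplicativeReductionAtPrime_iff_hasMultiplicativeReductionAt_ringOfIntegers W v).mp hmult
  have hWs : W.HasSplitMultiplicativeReductionAt v :=
    (hasSplitMultiplicativeReductionAtPrime_iff_hasSplitMultiplicativeReductionAt W v).mp hsplit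
  obtain ⟨-, hTord, hTs⟩ :=
    Summit.BirchSwinnertonDyer.Rank1Residual.AdditivePotMult.hasMultiplicativeReductionAt_and_split_iff_quadraticTwist_of_not_dvd
      W v hℓ2 hℓd hWv
  have hW' : W' = C⁻¹ • W.quadraticTwist (d : ℚ) := by rw [← hC, inv_smul_smul]
  refine ⟨Summit.BirchSwinnertonDyer.Rank1Residual.X2.hasMultiplicativeReductionAtPrime_of_smul_eq_quadraticTwist
      W W' hC _ hℓ2 hℓd hmult, ?_, ?_⟩
  · intro h'
    have h1 : W'.HasSplitMultiplicativeReductionAt v :=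
      (hasSplitMultiplicativeReductionAtPrime_iff_hasSplitMultiplicativeReductionAt W' v).mp h'
    rw [hW', hasSplitMultiplicativeReductionAt_smul_iff_holds v _ C⁻¹] at h1
    exact hns ((hTs.mp h1).mpr hWs)
  · rw [← LocalTorsionMult.ordMinimalDiscriminant_eq_padicValInt W' v rfl,
      ← LocalTorsionMult.ordMinimalDiscriminant_eq_padicValInt W v rfl, hW',
      ordMinimalDiscriminant_smul_holds v _ C⁻¹, hTord]

/-- A `ℚ`-model `V` of the quadratic twist `V₀^{(d)}` (`C • V = V₀^{(d)}`) has the same `j`-invariant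
as `V₀` (`j` is invariant under admissible changes of variables and under quadratic twists).
[cite: SilvermanAEC2009, III.1.4(b) and X.5 Cor. 5.4] -/
theorem j_eq_of_model_smul_eq_quadraticTwist {V₀ V : WeierstrassCurve ℚ} [V₀.IsElliptic]
    [V.IsElliptic] {C : VariableChange ℚ} {d : ℚ} (hd : d ≠ 0)
    (h : C • V = V₀.quadraticTwist d) : V.j = V₀.j := by
  haveI : NeZero (2 : ℚ) := ⟨two_ne_zero⟩
  haveI := V₀.isElliptic_quadraticTwist hd
  have h' : V = C⁻¹ • V₀.quadraticTwist d := by rw [← h, inv_smul_smul]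
  subst h'
  rw [WeierstrassCurve.variableChange_j, V₀.j_quadraticTwist hd]

/-- **Global part.** Let `C • W' = W^{(q)}` with `W, W'` globally minimal and `q` an odd prime
`≠ p` of GOOD reduction for `W`, `p` odd. If `W` is an X7 pair at `p` with `a_p = 0`, `ρ̄_{E,p}` onto
and no CM, so is `W'`: good supersingular with `a_p(W') = (q/p)·a_p(W) = 0` (`TwistStability`),
NOT semistable (additive at `q`: `not_semistable_of_smul_eq_quadraticTwist_of_odd_prime_dvd`), onto
(`ρ̄_{E^{(q)},p} ≅ ρ̄_{E,p} ⊗ χ_q`: `hasSurjectiveModNGaloisRep_pow_iff_of_model_twist`), same `j`.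
[cite: SilvermanAEC2009, X.5 Cor. 5.4 and III.1.4(b)] [cite: Knapp1993, Prop. 12.10] -/
theorem classX7_of_smul_eq_quadraticTwist_prime (p : ℕ) [Fact p.Prime] {q : ℕ} [Fact q.Prime]
    {C : VariableChange ℚ} (hC : C • W' = W.quadraticTwist ((q : ℤ) : ℚ)) (hp : p ≠ 2)
    (hq2 : q ≠ 2) (hqp : q ≠ p) (hqgood : W.HasGoodReductionAtPrime q) (hX : ClassX7 W p)
    (hcm : ¬ W.HasCM) (hap : W.frobeniusTrace p = 0) (hs : Surj W p) :
    ClassX7 W' p ∧ ¬ W'.HasCM ∧ W'.frobeniusTrace p = 0 ∧ Surj W' p := by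
  have hpP : p.Prime := Fact.out
  have hqP : q.Prime := Fact.out
  have hd : Squarefree (q : ℤ) := (Nat.prime_iff_prime_int.mp hqP).squarefree
  have hd0 : ((q : ℤ) : ℚ) ≠ 0 := by exact_mod_cast hqP.ne_zero
  haveI := W.isElliptic_quadraticTwist hd0
  haveI : NeZero (2 : ℚ) := ⟨two_ne_zero⟩
  have hpZ : Prime (p : ℤ) := Nat.prime_iff_prime_int.mp hpP
  have hp2d : ¬ (p : ℤ) ∣ 2 * (q : ℤ) := by
    intro h
    rcases hpZ.dvd_or_dvd h with h2 | hq
    · exact hp ((Nat.prime_dvd_prime_iff_eq hpP Nat.prime_two).mp (by exact_mod_cast h2))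
    · exact hqp ((Nat.prime_dvd_prime_iff_eq hpP hqP).mp (by exact_mod_cast hq)).symm
  have hW' : W' = C⁻¹ • W.quadraticTwist ((q : ℤ) : ℚ) := by rw [← hC, inv_smul_smul]
  refine ⟨⟨goodSS_of_smul_eq_quadraticTwist W W' p hX.1 hd hC hp2d,
    not_semistable_of_smul_eq_quadraticTwist_of_odd_prime_dvd W W' hd hC hq2 dvd_rfl hqgood⟩,
    ?_, ?_, ?_⟩
  · have hj : W'.j = W.j := j_eq_of_model_smul_eq_quadraticTwist hd0 hC
    exact fun h ↦ hcm ((hasCM_iff_of_j_eq hj).mp h)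
  · rw [frobeniusTrace_of_smul_eq_quadraticTwist W W' p hd hC hp2d hX.1.1, hap, mul_zero]
  · have h1 :=
      Summit.BirchSwinnertonDyer.Rank1Residual.GaloisImage.hasSurjectiveModNGaloisRep_pow_iff_of_model_twist
        W p hd0 (Wd := W') ⟨C⁻¹, hW'.symm⟩ 1
    rw [pow_one] at h1
    exact h1.mpr hs

/-- **Twist-to-locus.** Let `W` be an X7 pair at the odd prime `p` with `a_p = 0`, `ρ̄_{E,p}` onto, no
CM, and an ODD prime `ℓ ≠ p` of SPLIT multiplicative reduction with `p ∤ ord_ℓ Δ_min` (pieces B, C of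
the cell's off-locus partition). Then some prime `q ∉ {2, p}` of good reduction, a non-residue mod `ℓ`
(Dirichlet's theorem `Nat.forall_exists_prime_gt_and_eq_mod` in a non-square class of `(ℤ/ℓ)^×`), has a
twist `W^{(q)}` whose globally minimal models `W'` are X7 pairs at `p` with `a_p = 0`, `ρ̄` onto, no CM,
and lie ON the Fouquet–Wan locus at the SAME prime `ℓ` (non-split multiplicative, `ρ̄` still ramified:
same `ord_ℓ Δ_min`). A THEOREM (no binder); it asserts nothing about Kobayashi's conjecture.
[cite: SilvermanAEC2009, VII.5 Prop. 5.1(b), X.5 Cor. 5.4 and VIII.8 Cor. 8.3] -/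
theorem exists_twist_on_fwLocus_of_split_ram (p : ℕ) [Fact p.Prime] (hp : p ≠ 2)
    (hX : ClassX7 W p) (hcm : ¬ W.HasCM) (hap : W.frobeniusTrace p = 0) (hs : Surj W p)
    {ℓ : ℕ} [Fact ℓ.Prime] (hℓ2 : ℓ ≠ 2) (hℓp : ℓ ≠ p)
    (hmult : W.HasMultiplicativeReductionAtPrime ℓ) (hsplit : W.HasSplitMultiplicativeReductionAtPrime ℓ)
    (hram : ¬ p ∣ padicValInt ℓ W.minimalDiscriminantInt) :
    ∃ (q : ℕ) (_ : Fact q.Prime) (W' : WeierstrassCurve ℚ) (_ : W'.IsElliptic) (_ : W'.IsGloballyMinimal)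
      (C : VariableChange ℚ), q ≠ 2 ∧ q ≠ p ∧ C • W' = W.quadraticTwist ((q : ℤ) : ℚ) ∧
      ClassX7 W' p ∧ ¬ W'.HasCM ∧ W'.frobeniusTrace p = 0 ∧ Surj W' p ∧
      (ℓ ≠ p ∧ W'.HasMultiplicativeReductionAtPrime ℓ ∧ ¬ W'.HasSplitMultiplicativeReductionAtPrime ℓ ∧
        ¬ p ∣ padicValInt ℓ W'.minimalDiscriminantInt) := by
  have hℓP : ℓ.Prime := Fact.out
  -- a non-residue class mod `ℓ`
  haveI : NeZero ℓ := ⟨hℓP.ne_zero⟩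
  have hchar : ringChar (ZMod ℓ) ≠ 2 := by rw [ZMod.ringChar_zmod_n]; exact hℓ2
  obtain ⟨a, ha⟩ := FiniteField.exists_nonsquare hchar
  have ha0 : a ≠ 0 := by rintro rfl; exact ha (IsSquare.zero)
  have hau : IsUnit a := isUnit_iff_ne_zero.mpr ha0
  -- Dirichlet: a prime `q ≡ a (mod ℓ)` beyond `2`, `p` and `|Δ_min|`
  obtain ⟨q, hqgt, hqP, hqa⟩ := Nat.forall_exists_prime_gt_and_eq_mod hau
    (2 + p + W.minimalDiscriminantInt.natAbs)
  haveI : Fact q.Prime := ⟨hqP⟩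
  have hq2 : q ≠ 2 := by omega
  have hqp : q ≠ p := by omega
  have hΔ0 : W.minimalDiscriminantInt ≠ 0 := minimalDiscriminantInt_ne_zero W
  have hqΔ : ¬ (q : ℤ) ∣ W.minimalDiscriminantInt := by
    intro h
    have h1 : q ∣ W.minimalDiscriminantInt.natAbs := Int.natCast_dvd.mp h
    have h2 := Nat.le_of_dvd (Int.natAbs_pos.mpr hΔ0) h1
    omega
  have hqgood : W.HasGoodReductionAtPrime q := hasGoodReductionAtPrime_of_not_dvd W q hqΔ
  have hℓq : ¬ (ℓ : ℤ) ∣ (q : ℤ) := by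
    intro h
    have h' : ((q : ℤ) : ZMod ℓ) = 0 := (ZMod.intCast_zmod_eq_zero_iff_dvd _ ℓ).mpr h
    rw [Int.cast_natCast, hqa] at h'
    exact ha0 h'
  have hns : ¬ IsSquare (((q : ℤ) : ℤ) : ZMod ℓ) := by
    rw [Int.cast_natCast, hqa]; exact ha
  -- a globally minimal model of the twist
  have hd0 : ((q : ℤ) : ℚ) ≠ 0 := by exact_mod_cast hqP.ne_zero
  obtain ⟨W', hE', hM', C, hC⟩ := exists_isGloballyMinimal_smul_eq_quadraticTwist W hd0
  obtain ⟨hX', hcm', hap', hs'⟩ :=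
    classX7_of_smul_eq_quadraticTwist_prime W W' p hC hp hq2 hqp hqgood hX hcm hap hs
  obtain ⟨hm', hns', hord⟩ :=
    nonsplit_of_smul_eq_quadraticTwist_of_not_isSquare W W' hC ℓ hℓ2 hℓq hns hmult hsplit
  exact ⟨q, ⟨hqP⟩, W', hE', hM', C, hq2, hqp, hC, hX', hcm', hap', hs', hℓp, hm', hns',
    by rw [hord]; exact hram⟩

/-- **Modulo the Fouquet–Wan binder, every piece-B/C curve has a quadratic twist satisfying
Kobayashi's main conjecture (both signs).** With `W`, `p`, `ℓ` as in
`exists_twist_on_fwLocus_of_split_ram`: IF `FouquetWan2021_thm451_via_kobayashi74_OPEN` holds (`hFW`,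
UNREFEREED), then some twist `W^{(q)}` (any globally minimal model `W'`) satisfies
`KobayashiMainConjecture W' p ε` for every `ε` (`X7.kobayashiMainConjecture_of_thm451_OPEN_of_surj` at
the twist). This does NOT give the conjecture for `W` (no twist descent is known or claimed); it
records that off the locus the missing input is a twist-descent statement. CONDITIONAL; closes nothing.
[claim: FouquetWan2021, status: under-review] [cite: Kobayashi2003, Thm. 7.4 (p. 13) and Conjecture (p. 2)] -/
theorem exists_twist_kobayashiMainConjecture_of_thm451_OPEN
    (hFW : FouquetWan2021_thm451_via_kobayashi74_OPEN) (p : ℕ) [Fact p.Prime] (hp : p ≠ 2)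
    (hX : ClassX7 W p) (hcm : ¬ W.HasCM) (hap : W.frobeniusTrace p = 0) (hs : Surj W p)
    {ℓ : ℕ} [Fact ℓ.Prime] (hℓ2 : ℓ ≠ 2) (hℓp : ℓ ≠ p)
    (hmult : W.HasMultiplicativeReductionAtPrime ℓ) (hsplit : W.HasSplitMultiplicativeReductionAtPrime ℓ)
    (hram : ¬ p ∣ padicValInt ℓ W.minimalDiscriminantInt) :
    ∃ (q : ℕ) (_ : Fact q.Prime) (W' : WeierstrassCurve ℚ) (_ : W'.IsElliptic) (_ : W'.IsGloballyMinimal)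
      (C : VariableChange ℚ), q ≠ 2 ∧ q ≠ p ∧ C • W' = W.quadraticTwist ((q : ℤ) : ℚ) ∧
      ∀ ε : ℤˣ, KobayashiMainConjecture W' p ε := by
  obtain ⟨q, hq, W', hE', hM', C, hq2, hqp, hC, hX', -, hap', hs', hloc⟩ :=
    exists_twist_on_fwLocus_of_split_ram W p hp hX hcm hap hs hℓ2 hℓp hmult hsplit hram
  exact ⟨q, hq, W', hE', hM', C, hq2, hqp, hC,
    X7.kobayashiMainConjecture_of_thm451_OPEN_of_surj W' p hFW hp hX' hap' hs' ⟨ℓ, inferInstance, hloc⟩⟩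

end TwistToLocus


/-! ### APPEND (gen 3, same seat): the dyadic (ram) prime, and the parity-free statement

The unit-twist lemma used above excludes the place `2`. At `ℓ = 2` the twist by a prime
`q ≡ 5 (mod 8)` does the same job: `ℚ₂(√q)/ℚ₂` is the UNRAMIFIED quadratic extension, so a
multiplicative place stays multiplicative with the same `ord₂ Δ_min` and split ↔ non-split are
EXCHANGED (tree `AdditivePotMult.hasMultiplicativeReductionAt_and_split_iff_quadraticTwist_two`:
split iff (`2 ∣ (d−1)/4` iff split), and `(q−1)/4` is odd). With Dirichlet mod `8` this removes the
parity hypothesis on `ℓ`: `exists_twist_on_fwLocus_of_split_ram'` covers EVERY X7 large-image curve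
with a split `ρ̄`-ramified multiplicative prime (all 254 (ram)-bearing off-locus window pairs, incl.
the 5 whose (ram) primes are ⊆ {2}: 14450q1@3, 18818c1@3, 18050w1@3, 311542cz1@3, 337014bh1@7).
-/

section TwistToLocusTwo

variable (W W' : WeierstrassCurve ℚ) [W.IsElliptic] [W.IsGloballyMinimal] [W'.IsElliptic]
  [W'.IsGloballyMinimal]

/-- **Local part at `ℓ = 2`.** Let `C • W' = W^{(d)}` with `W, W'` globally minimal, `d ≡ 5 (mod 8)`,
and `W` SPLIT multiplicative at `2`. Then `W'` is NON-SPLIT multiplicative at `2` with the same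
`ord₂ Δ_min`: the twist by `d = 1 + 4c`, `c` odd, is the unramified quadratic twist at `2`, which keeps
the type and `ord Δ_min` and exchanges split/non-split (`…_quadraticTwist_two`); all three are
`ℚ`-isomorphism invariants. (Stated for a prime `ℓ` with `ℓ = 2` to match the shape of the odd case.)
[cite: SilvermanAEC2009, VII.5 Prop. 5.1(b), X.5 Cor. 5.4 and App. A Prop. A.1.1] -/
theorem nonsplit_of_smul_eq_quadraticTwist_two {d : ℤ} {C : VariableChange ℚ}
    (hC : C • W' = W.quadraticTwist (d : ℚ)) (ℓ : ℕ) [Fact ℓ.Prime] (hℓ : ℓ = 2) (hd8 : d % 8 = 5)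
    (hmult : W.HasMultiplicativeReductionAtPrime ℓ) (hsplit : W.HasSplitMultiplicativeReductionAtPrime ℓ) :
    W'.HasMultiplicativeReductionAtPrime ℓ ∧ ¬ W'.HasSplitMultiplicativeReductionAtPrime ℓ ∧
      padicValInt ℓ W'.minimalDiscriminantInt = padicValInt ℓ W.minimalDiscriminantInt := by
  have hd0' : d ≠ 0 := by
    intro h
    rw [h] at hd8
    norm_num at hd8
  have hd0 : (d : ℚ) ≠ 0 := by exact_mod_cast hd0'
  haveI := W.isElliptic_quadraticTwist hd0
  obtain ⟨v, rfl⟩ : ∃ v : HeightOneSpectrum (𝓞 ℚ), ((primesEquiv v : ℕ)) = ℓ :=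
    ⟨primesEquiv.symm ⟨ℓ, Fact.out⟩, by rw [Equiv.apply_symm_apply]⟩
  have hWv : W.HasMultiplicativeReductionAt v :=
    (hasMultiplicativeReductionAtPrime_iff_hasMultiplicativeReductionAt_ringOfIntegers W v).mp hmult
  have hWs : W.HasSplitMultiplicativeReductionAt v :=
    (hasSplitMultiplicativeReductionAtPrime_iff_hasSplitMultiplicativeReductionAt W v).mp hsplit
  have hd4 : d % 4 = 1 := by omega
  obtain ⟨hTm, hTord, hTs⟩ :=
    Summit.BirchSwinnertonDyer.Rank1Residual.AdditivePotMult.hasMultiplicativeReductionAt_and_split_iff_quadraticTwist_two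
      (V := W) (v := v) hℓ hd4 hWv
  have hW' : W' = C⁻¹ • W.quadraticTwist (d : ℚ) := by rw [← hC, inv_smul_smul]
  have hodd : ¬ (2 : ℤ) ∣ (d - 1) / 4 := by omega
  refine ⟨?_, ?_, ?_⟩
  · have h1 : W'.HasMultiplicativeReductionAt v := by
      rw [hW', hasMultiplicativeReductionAt_smul_iff_holds v _ C⁻¹]
      exact hTm
    exact (hasMultiplicativeReductionAtPrime_iff_hasMultiplicativeReductionAt_ringOfIntegers W' v).mpr h1
  · intro h'
    have h1 : W'.HasSplitMultiplicativeReductionAt v :=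
      (hasSplitMultiplicativeReductionAtPrime_iff_hasSplitMultiplicativeReductionAt W' v).mp h'
    rw [hW', hasSplitMultiplicativeReductionAt_smul_iff_holds v _ C⁻¹] at h1
    exact hodd ((hTs.mp h1).mpr hWs)
  · rw [← LocalTorsionMult.ordMinimalDiscriminant_eq_padicValInt W' v rfl,
      ← LocalTorsionMult.ordMinimalDiscriminant_eq_padicValInt W v rfl, hW',
      ordMinimalDiscriminant_smul_holds v _ C⁻¹, hTord]

/-- **Twist-to-locus at the dyadic (ram) prime.** As `exists_twist_on_fwLocus_of_split_ram`, for a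
prime `ℓ = 2 ≠ p` of SPLIT multiplicative reduction with `p ∤ ord₂ Δ_min`: a prime `q ≡ 5 (mod 8)`
beyond `p` and `|Δ_min|` (Dirichlet) gives a twist `W^{(q)}` whose globally minimal models are X7 pairs
at `p` with `a_p = 0`, `ρ̄` onto, no CM, NON-split multiplicative at `2` with the same `ord₂ Δ_min` — ON
the Fouquet–Wan locus at `2`. A THEOREM; nothing about Kobayashi's conjecture is asserted.
[cite: SilvermanAEC2009, VII.5 Prop. 5.1(b), X.5 Cor. 5.4 and VIII.8 Cor. 8.3] -/
theorem exists_twist_on_fwLocus_of_split_ram_two (p : ℕ) [Fact p.Prime] (hp : p ≠ 2)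
    (hX : ClassX7 W p) (hcm : ¬ W.HasCM) (hap : W.frobeniusTrace p = 0) (hs : Surj W p)
    {ℓ : ℕ} [Fact ℓ.Prime] (hℓ : ℓ = 2)
    (hmult : W.HasMultiplicativeReductionAtPrime ℓ) (hsplit : W.HasSplitMultiplicativeReductionAtPrime ℓ)
    (hram : ¬ p ∣ padicValInt ℓ W.minimalDiscriminantInt) :
    ∃ (q : ℕ) (_ : Fact q.Prime) (W' : WeierstrassCurve ℚ) (_ : W'.IsElliptic) (_ : W'.IsGloballyMinimal)
      (C : VariableChange ℚ), q ≠ 2 ∧ q ≠ p ∧ C • W' = W.quadraticTwist ((q : ℤ) : ℚ) ∧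
      ClassX7 W' p ∧ ¬ W'.HasCM ∧ W'.frobeniusTrace p = 0 ∧ Surj W' p ∧
      (ℓ ≠ p ∧ W'.HasMultiplicativeReductionAtPrime ℓ ∧ ¬ W'.HasSplitMultiplicativeReductionAtPrime ℓ ∧
        ¬ p ∣ padicValInt ℓ W'.minimalDiscriminantInt) := by
  -- Dirichlet: a prime `q ≡ 5 (mod 8)` beyond `2`, `p` and `|Δ_min|`
  have h5 : IsUnit (5 : ZMod 8) := by decide
  obtain ⟨q, hqgt, hqP, hqa⟩ := Nat.forall_exists_prime_gt_and_eq_mod h5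
    (2 + p + W.minimalDiscriminantInt.natAbs)
  haveI : Fact q.Prime := ⟨hqP⟩
  have hq2 : q ≠ 2 := by omega
  have hqp : q ≠ p := by omega
  have hq8 : q % 8 = 5 := by
    have h := (ZMod.natCast_eq_natCast_iff' q 5 8).mp (by rw [hqa]; rfl)
    norm_num at h
    exact h
  have hd8 : (q : ℤ) % 8 = 5 := by exact_mod_cast congrArg (Nat.cast : ℕ → ℤ) hq8
  have hΔ0 : W.minimalDiscriminantInt ≠ 0 := minimalDiscriminantInt_ne_zero W
  have hqΔ : ¬ (q : ℤ) ∣ W.minimalDiscriminantInt := by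
    intro h
    have h1 : q ∣ W.minimalDiscriminantInt.natAbs := Int.natCast_dvd.mp h
    have h2 := Nat.le_of_dvd (Int.natAbs_pos.mpr hΔ0) h1
    omega
  have hqgood : W.HasGoodReductionAtPrime q := hasGoodReductionAtPrime_of_not_dvd W q hqΔ
  -- a globally minimal model of the twist
  have hd0 : ((q : ℤ) : ℚ) ≠ 0 := by exact_mod_cast hqP.ne_zero
  obtain ⟨W', hE', hM', C, hC⟩ := exists_isGloballyMinimal_smul_eq_quadraticTwist W hd0
  obtain ⟨hX', hcm', hap', hs'⟩ :=
    classX7_of_smul_eq_quadraticTwist_prime W W' p hC hp hq2 hqp hqgood hX hcm hap hs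
  obtain ⟨hm', hns', hord⟩ :=
    nonsplit_of_smul_eq_quadraticTwist_two W W' hC ℓ hℓ hd8 hmult hsplit
  have hℓp : ℓ ≠ p := by rw [hℓ]; exact fun h ↦ hp h.symm
  exact ⟨q, ⟨hqP⟩, W', hE', hM', C, hq2, hqp, hC, hX', hcm', hap', hs', hℓp, hm', hns',
    by rw [hord]; exact hram⟩

/-- **Twist-to-locus, parity-free.** For EVERY X7 pair `W` at the odd prime `p` with `a_p = 0`,
`ρ̄_{E,p}` onto, no CM, and a prime `ℓ ≠ p` (odd or `2`) of SPLIT multiplicative reduction with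
`p ∤ ord_ℓ Δ_min`, there are a prime `q ∉ {2, p}` and a globally minimal model `W'` of `W^{(q)}` which
is an X7 pair at `p` with `a_p = 0`, `ρ̄` onto, no CM, and lies ON the Fouquet–Wan locus at `ℓ`
(`exists_twist_on_fwLocus_of_split_ram` for odd `ℓ`, `…_two` for `ℓ = 2`). A THEOREM (no binder).
[cite: SilvermanAEC2009, VII.5 Prop. 5.1(b), X.5 Cor. 5.4 and VIII.8 Cor. 8.3] -/
theorem exists_twist_on_fwLocus_of_split_ram' (p : ℕ) [Fact p.Prime] (hp : p ≠ 2)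
    (hX : ClassX7 W p) (hcm : ¬ W.HasCM) (hap : W.frobeniusTrace p = 0) (hs : Surj W p)
    {ℓ : ℕ} [Fact ℓ.Prime] (hℓp : ℓ ≠ p)
    (hmult : W.HasMultiplicativeReductionAtPrime ℓ) (hsplit : W.HasSplitMultiplicativeReductionAtPrime ℓ)
    (hram : ¬ p ∣ padicValInt ℓ W.minimalDiscriminantInt) :
    ∃ (q : ℕ) (_ : Fact q.Prime) (W' : WeierstrassCurve ℚ) (_ : W'.IsElliptic) (_ : W'.IsGloballyMinimal)
      (C : VariableChange ℚ), q ≠ 2 ∧ q ≠ p ∧ C • W' = W.quadraticTwist ((q : ℤ) : ℚ) ∧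
      ClassX7 W' p ∧ ¬ W'.HasCM ∧ W'.frobeniusTrace p = 0 ∧ Surj W' p ∧
      (ℓ ≠ p ∧ W'.HasMultiplicativeReductionAtPrime ℓ ∧ ¬ W'.HasSplitMultiplicativeReductionAtPrime ℓ ∧
        ¬ p ∣ padicValInt ℓ W'.minimalDiscriminantInt) := by
  by_cases hℓ : ℓ = 2
  · exact exists_twist_on_fwLocus_of_split_ram_two W p hp hX hcm hap hs hℓ hmult hsplit hram
  · exact exists_twist_on_fwLocus_of_split_ram W p hp hX hcm hap hs hℓ hℓp hmult hsplit hram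

/-- **Modulo the Fouquet–Wan binder, EVERY curve with a split `ρ̄`-ramified multiplicative prime
(pieces B ∪ C, all 237 window pairs) has a quadratic twist satisfying Kobayashi's main conjecture,
both signs** — the parity-free form of `exists_twist_kobayashiMainConjecture_of_thm451_OPEN`. No
descent to `W` is claimed. CONDITIONAL; closes nothing. [claim: FouquetWan2021, status: under-review]
[cite: Kobayashi2003, Thm. 7.4 (p. 13) and Conjecture (p. 2)] -/
theorem exists_twist_kobayashiMainConjecture_of_thm451_OPEN'
    (hFW : FouquetWan2021_thm451_via_kobayashi74_OPEN) (p : ℕ) [Fact p.Prime] (hp : p ≠ 2)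
    (hX : ClassX7 W p) (hcm : ¬ W.HasCM) (hap : W.frobeniusTrace p = 0) (hs : Surj W p)
    {ℓ : ℕ} [Fact ℓ.Prime] (hℓp : ℓ ≠ p)
    (hmult : W.HasMultiplicativeReductionAtPrime ℓ) (hsplit : W.HasSplitMultiplicativeReductionAtPrime ℓ)
    (hram : ¬ p ∣ padicValInt ℓ W.minimalDiscriminantInt) :
    ∃ (q : ℕ) (_ : Fact q.Prime) (W' : WeierstrassCurve ℚ) (_ : W'.IsElliptic) (_ : W'.IsGloballyMinimal)
      (C : VariableChange ℚ), q ≠ 2 ∧ q ≠ p ∧ C • W' = W.quadraticTwist ((q : ℤ) : ℚ) ∧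
      ∀ ε : ℤˣ, KobayashiMainConjecture W' p ε := by
  obtain ⟨q, hq, W', hE', hM', C, hq2, hqp, hC, hX', -, hap', hs', hloc⟩ :=
    exists_twist_on_fwLocus_of_split_ram' W p hp hX hcm hap hs hℓp hmult hsplit hram
  exact ⟨q, hq, W', hE', hM', C, hq2, hqp, hC,
    X7.kobayashiMainConjecture_of_thm451_OPEN_of_surj W' p hFW hp hX' hap' hs' ⟨ℓ, inferInstance, hloc⟩⟩

end TwistToLocusTwo

end Summit.BirchSwinnertonDyer.BirchSwinnertonDyer.Theorems

end
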